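/-
Copyright: the b2b-balaban T⁴-continuum CRUX team, row NE7b leaf lineage `t4-ne7b-formalise-leaf-03` (gen 145). Project licence.
-/
import Mathlib.Analysis.InnerProductSpace.Adjoint
import Mathlib.Analysis.Calculus.Gradient.Basic
import Mathlib.Analysis.Calculus.LocalExtr.Basic
import Mathlib.Analysis.Calculus.Deriv.Add
import Mathlib.Analysis.Calculus.Deriv.Mul
import Mathlib.Analysis.Calculus.Deriv.Comp

/-!
# THE ENVELOPE THEOREM FOR THE HARD CONSTRAINT: the value function `φ w = inf {V δ : D δ = w}` of a convex `V` with a constrained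
# minimiser `δ₀` over `w` is DIFFERENTIABLE at `w`, `Dφ(w) = DV(δ₀) ∘ M` for ANY linear right inverse `M` of `D` (the Lagrange multiplier:
# `∇φ(w) = M†∇V(δ₀) =: λ`, `D†λ = ∇V(δ₀)`), and `φ` obeys the road's FIRST-ORDER letter with its own derivative and the CONSTRAINED SCHUR
# FORM of `V`'s modulus — the first-order half of T-80 (J1) «`Λ_V` = the multiplier = `Dφ_k(V)` read through `DŪ`», the `a = ∞` twin of
# `…FluctuationStepDeriv` ∕ `…FluctuationStepLetters` (row NE7b, node U5c; residual (R2′) family (2), letter (ℓ1); Mathlib only)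

Cell `pub-balaban`, sub-cell `t4`, spine estimate NE7b (`T4WeightBudget.RelWeightBound`; the cell's OWN estimate — NOT PRINTED in
[Bałaban 1983–89], NOT PROVED).  Crux-route work under `Spine/NE7b/` by a row leaf on the convexity road; NOTHING of Bałaban's is named
or asserted; no `T4Continuum/Support` leaf typed (FREEZE (0)); no `def`; zero `sorry`.  Imports: Mathlib only — independent of the
farm's olean frontier.

WHY.  `…ConstrainedSchurForm` (this lineage, gen 144) typed the HARD-CONSTRAINT Schur form `Q_D w = inf {Q δ : D δ = w}` and showed that
the SECANT letter of `V` passes to the value function `φ w = inf {V δ : D δ = w}` with modulus `Q_D` (§6 there; the upper letter in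
`…ConstrainedSchurTower` §3) — zeroth-plus-second-order currency, no derivative.  The road's SOCKETS are written in FIRST-ORDER currency
(`V⁺ψ + DV⁺(ψ)(ψ′ − ψ) + (λ∕2)‖ψ′ − ψ‖² ≤ V⁺ψ′`; the OWNER's `…FluctuationStepLetters.stepMarginal_firstOrder` for the fluctuation
INTEGRAL, with `…FluctuationStepDeriv`: «the next action is differentiable everywhere, derivative = the tilted mean»).  THIS FILE is the
MINIMISATION (`a = ∞`) twin: the value function of a linearly constrained convex minimum is differentiable wherever a constrained minimiser
exists, its derivative is the Lagrange multiplier — `DV(δ₀)` read through ANY right inverse `M` of the constraint map, independently of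
`M` because `DV(δ₀)` annihilates `ker D` (Fermat on the fibre) — and the first-order letter of `V` with modulus form `Q` descends to `φ`
with modulus `Q_D`.  T-80 (J1) (idea-1 g80) names exactly this object: «`Λ_V` = the multiplier = `Dφ_k(V)` read through `DŪ`»; its
second-order half (the constrained Schur complement of `∇²A + Λ_V·∇²Ū` under non-degeneracy) stays NOT HERE.

WHAT IS PROVED ([folklore]; Borwein–Lewis, *Convex Analysis and Nonlinear Optimization* (2000) §3.2–§4.3 (value function, Lagrangian
necessary conditions, sensitivity); Rockafellar–Wets, *Variational Analysis* Thm 10.13 (subgradients of an infimal projection)):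
* §1 FERMAT ON THE FIBRE `deriv_apply_eq_zero_of_isMinOn_fibre`: `D δ₀ = w`, `V δ₀ ≤ V δ` on the fibre `{D δ = w}`, `HasFDerivAt V V′ δ₀`
  ⊢ `V′ κ = 0` for every `κ ∈ ker D` (the line `δ₀ + tκ` stays in the fibre; `IsLocalMin.hasDerivAt_eq_zero`).
* §2 THE MULTIPLIER IS CHART-FREE: a functional `ℓ` annihilating `ker D` reads the same through any two right inverses
  (`comp_rightInverse_eq`), and `ℓ (δ − δ₀) = ℓ (M (w′ − w))` for ALL `δ` over `w′` (`apply_sub_eq_apply_rightInverse`).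
* §3 THE FIRST-ORDER LETTER DESCENDS `firstOrder_constrValue`: `V` bounded below, `Q ≥ 0`, `ℓ` annihilating `ker D`, the letter
  `V δ₀ + ℓ (δ − δ₀) + Q (δ − δ₀) ≤ V δ` at a fibre point `δ₀` of `w` ⊢ `φ w + ℓ (M (w′ − w)) + Q_D (w′ − w) ≤ φ w′` for every `w′` —
  the socket letter for `φ`, with `Q_D v = ⨅_{D δ = v} Q δ` VERBATIM `…ConstrainedSchurForm` §1's form.
* §4 THE ENVELOPE THEOREM `hasFDerivAt_constrValue`: `V` bounded below, `δ₀` a constrained minimiser over `w`, `HasFDerivAt V V′ δ₀`, the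
  convexity letter at `δ₀` (`V δ₀ + V′ (δ − δ₀) ≤ V δ`) ⊢ `HasFDerivAt φ (V′ ∘L M) w` (lower bound = §3 with `Q = 0`; upper bound
  = `φ (w + h) ≤ V (δ₀ + M h)` and the chain rule; squeeze in `o(h)`); `fderiv_constrValue` (`fderiv ℝ φ w = V′ ∘L M`);
  **`firstOrder_constrValue_fderiv`** — §3 with `ℓ = V′` re-written with `φ`'s OWN derivative:
  `φ w + fderiv φ w (w′ − w) + Q_D (w′ − w) ≤ φ w′` (the END: the road's first-order letter for the constrained value function).
* §5 GRADIENT ∕ MULTIPLIER CURRENCY (complete inner product spaces): `hasGradientAt_constrValue` (`∇φ(w) = M†∇V(δ₀)`),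
  **`adjoint_apply_multiplier`** (THE LAGRANGE CONDITION `D†(M†g) = g` for every `g ⊥ ker D` — `…ConstrainedSchurForm`'s letter
  `H M = D†Λ` at a point), `multiplier_unique` (`D†λ₁ = D†λ₂ → λ₁ = λ₂`, through `M†D† = 1`), `adjoint_rightInverse_comp` (`M†D† = 1`).
* §6 EVERYWHERE, FROM THE DATA ALONE (proper `E`, e.g. finite-dimensional): `lt_of_firstOrder_of_norm_gt` (coercivity: `V δ₁ < V δ` once
  `‖δ − δ₁‖ > 2‖ℓ‖∕m` — SHARP), `bddBelow_of_firstOrder` (`V ≥ V δ₁ − ‖ℓ‖²∕(2m)`), **`exists_isMinOn_fibre`** (the constrained minimiser EXISTS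
  over every `w`: minimise over the compact `fibre ∩ closedBall`), **`hasFDerivAt_constrValue_of_firstOrder`** (a derivative FIELD `V′` and the
  strong letter `V δ + V′ δ (δ′ − δ) + Q (δ′ − δ) ≤ V δ′` at EVERY point with `Q ≥ (m∕2)‖·‖²`, `m > 0` ⊢ over every `w` a minimiser `δ₀` and
  `HasFDerivAt φ (V′ δ₀ ∘L M) w`), **`firstOrder_constrValue_of_firstOrder`** (`φ` differentiable everywhere and
  `φ w + fderiv φ w (w′ − w) + Q_D (w′ − w) ≤ φ w′` for ALL `w, w′` — the sockets' letter for the constrained value function from the step's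
  data `(V′, Q, D, M)` alone, the `a = ∞` twin of `…FluctuationStepLetters.stepMarginal_firstOrder`).
* §7 a non-vacuity `example` (`D = M = id`: `φ = V`, the theorem returns `HasFDerivAt V V′`).

NOT HERE (honest): the SECOND-ORDER sensitivity theorem (T-80 (J1) proper: `D²φ` = the constrained Schur complement of `∇²V + Λ·∇²(constraint)`
under non-degeneracy — implicit-function territory); convexity ∕ the secant letter of `φ` (`…ConstrainedSchurForm` §6, `…ConstrainedSchurTower`
§3); the floor `Q_D ≥ (γ∕q²)‖·‖²` of the constrained Schur form (`…ConstrainedSchurForm` §2, by name when its olean builds — not imported here);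
NONLINEAR constraints; which `V`, `D` of Bałaban's ((A3) ∕ (A1c), NC-NE7b-α UNRULED); any value.
BY-NAME EFFECT ON THE WALL: NONE.  NE7b NOT PRINTED ∕ NOT PROVED; spine PROVED 0∕9; rung (B)+1 on a FINITE torus — NOT infinite volume,
NOT the mass gap, NOT Clay.  HONEST DEPENDENCY: continuum YM on T⁴ ⇐ BetaPertH ∧ nine spine estimates (0/9 proved); BetaPertH ⇐ (D1) ∧
(D4) ∧ CAP+tail.
-/

set_option autoImplicit false

open Set Function Filter Asymptotics
open scoped RealInnerProductSpace Topology
namespace Summit.QuantumFields.BalabanUV.T4Continuum.NE7b.ConstrainedValueDeriv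

/-! ## §1 Fermat on the fibre: at a constrained minimiser the derivative annihilates `ker D` -/

section Fermat

variable {E F : Type*} [NormedAddCommGroup E] [NormedSpace ℝ E] [NormedAddCommGroup F] [NormedSpace ℝ F]

/-- **FERMAT ON THE FIBRE.**  `δ₀` minimises `V` on the fibre `{δ : D δ = w}` and `V` is differentiable at `δ₀` ⟹ `V′ κ = 0` for every
`κ` with `D κ = 0`: the line `t ↦ δ₀ + t • κ` stays in the fibre, so `t ↦ V (δ₀ + t • κ)` has a minimum at `0`. [folklore] -/
theorem deriv_apply_eq_zero_of_isMinOn_fibre {V : E → ℝ} {V' : E →L[ℝ] ℝ} {D : E →L[ℝ] F} {w : F} {δ₀ : E} (hδ₀ : D δ₀ = w)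
    (hmin : ∀ δ, D δ = w → V δ₀ ≤ V δ) (hV : HasFDerivAt V V' δ₀) {κ : E} (hκ : D κ = 0) : V' κ = 0 := by
  have hline : HasDerivAt (fun t : ℝ => δ₀ + t • κ) κ 0 := by simpa using ((hasDerivAt_id (0 : ℝ)).smul_const κ).const_add δ₀
  have hV0 : HasFDerivAt V V' (δ₀ + (0 : ℝ) • κ) := by simpa using hV
  have hg := hV0.comp_hasDerivAt (0 : ℝ) hline
  have hloc : IsLocalMin (V ∘ fun t : ℝ => δ₀ + t • κ) 0 :=
    Filter.Eventually.of_forall fun t => by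
      simpa using hmin (δ₀ + t • κ) (by rw [map_add, map_smul, hκ, smul_zero, add_zero, hδ₀])
  exact hloc.hasDerivAt_eq_zero hg

end Fermat

/-! ## §2 The multiplier is chart-free: a functional annihilating `ker D` reads the same through every right inverse -/

section ChartFree

variable {E F : Type*} [NormedAddCommGroup E] [NormedSpace ℝ E] [NormedAddCommGroup F] [NormedSpace ℝ F]

/-- **INDEPENDENCE OF THE RIGHT INVERSE.**  `ℓ` annihilates `ker D`, `M`, `M′` two right inverses of `D` ⟹ `ℓ ∘ M = ℓ ∘ M′`
(`M h − M′ h ∈ ker D`). [folklore] -/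
theorem comp_rightInverse_eq {ℓ : E →L[ℝ] ℝ} {D : E →L[ℝ] F} (hker : ∀ κ, D κ = 0 → ℓ κ = 0) {M M' : F →L[ℝ] E}
    (hM : ∀ w, D (M w) = w) (hM' : ∀ w, D (M' w) = w) : ℓ.comp M = ℓ.comp M' := by
  ext h
  have h0 := hker (M h - M' h) (by rw [map_sub, hM, hM', sub_self])
  rw [map_sub, sub_eq_zero] at h0
  simpa using h0

/-- **EVERY FIBRE POINT READS THE SAME LINEAR TERM.**  `ℓ` annihilates `ker D`, `D δ₀ = w`, `D δ = w′` ⟹ `ℓ (δ − δ₀) = ℓ (M (w′ − w))`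
(`δ − δ₀ − M (w′ − w) ∈ ker D`). [folklore] -/
theorem apply_sub_eq_apply_rightInverse {ℓ : E →L[ℝ] ℝ} {D : E →L[ℝ] F} (hker : ∀ κ, D κ = 0 → ℓ κ = 0) {M : F →L[ℝ] E}
    (hM : ∀ w, D (M w) = w) {δ₀ δ : E} {w w' : F} (hδ₀ : D δ₀ = w) (hδ : D δ = w') : ℓ (δ - δ₀) = ℓ (M (w' - w)) := by
  have h0 := hker (δ - δ₀ - M (w' - w)) (by rw [map_sub, map_sub, hδ, hδ₀, hM, sub_self])
  rwa [map_sub, sub_eq_zero] at h0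

end ChartFree

/-! ## §3 The first-order letter descends to the value function with the constrained Schur form of the modulus -/

section FirstOrder

variable {E F : Type*} [NormedAddCommGroup E] [NormedSpace ℝ E] [NormedAddCommGroup F] [NormedSpace ℝ F]

/-- **THE FIRST-ORDER LETTER OF `V` DESCENDS TO `φ w = ⨅_{D δ = w} V δ`.**  `V` bounded below, `Q ≥ 0`, `M` a right inverse of `D`,
`δ₀` a fibre point of `w` at which `ℓ` annihilates `ker D` and `V` obeys the first-order letter with linear term `ℓ` and modulus form `Q`
(`V δ₀ + ℓ (δ − δ₀) + Q (δ − δ₀) ≤ V δ` for all `δ`) ⟹ for every `w′`: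
`φ w + ℓ (M (w′ − w)) + Q_D (w′ − w) ≤ φ w′`, `Q_D v = ⨅_{D δ = v} Q δ` (the constrained Schur form of `…ConstrainedSchurForm` §1).
Proof: `φ w ≤ V δ₀`; on the fibre of `w′` the linear term is constant (§2) and `Q (δ − δ₀) ≥ Q_D (w′ − w)`. [folklore] -/
theorem firstOrder_constrValue {V Q : E → ℝ} {ℓ : E →L[ℝ] ℝ} {D : E →L[ℝ] F} {M : F →L[ℝ] E} (hM : ∀ w, D (M w) = w)
    (hbdd : ∃ m, ∀ δ, m ≤ V δ) (hQ0 : ∀ δ, 0 ≤ Q δ) {w : F} {δ₀ : E} (hδ₀ : D δ₀ = w) (hker : ∀ κ, D κ = 0 → ℓ κ = 0)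
    (hfo : ∀ δ, V δ₀ + ℓ (δ - δ₀) + Q (δ - δ₀) ≤ V δ) (w' : F) :
    (⨅ δ : {δ // D δ = w}, V δ.1) + ℓ (M (w' - w)) + (⨅ δ : {δ // D δ = w' - w}, Q δ.1) ≤ ⨅ δ : {δ // D δ = w'}, V δ.1 := by
  obtain ⟨m, hm⟩ := hbdd
  have hbddV : ∀ v, BddBelow (range fun δ : {δ // D δ = v} => V δ.1) :=
    fun v => ⟨m, forall_mem_range.2 fun δ => hm δ.1⟩
  have hbddQ : ∀ v, BddBelow (range fun δ : {δ // D δ = v} => Q δ.1) :=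
    fun v => ⟨0, forall_mem_range.2 fun δ => hQ0 δ.1⟩
  haveI : Nonempty {δ // D δ = w'} := ⟨⟨M w', hM w'⟩⟩
  have hφw : (⨅ δ : {δ // D δ = w}, V δ.1) ≤ V δ₀ := ciInf_le (hbddV w) ⟨δ₀, hδ₀⟩
  have key : ∀ δ : {δ // D δ = w'}, V δ₀ + ℓ (M (w' - w)) + (⨅ δ' : {δ' // D δ' = w' - w}, Q δ'.1) ≤ V δ.1 := by
    rintro ⟨δ, hδ⟩
    have h1 : ℓ (δ - δ₀) = ℓ (M (w' - w)) := apply_sub_eq_apply_rightInverse hker hM hδ₀ hδ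
    have h2 : (⨅ δ' : {δ' // D δ' = w' - w}, Q δ'.1) ≤ Q (δ - δ₀) :=
      ciInf_le (hbddQ _) ⟨δ - δ₀, by rw [map_sub, hδ, hδ₀]⟩
    have h3 := hfo δ
    rw [h1] at h3
    linarith
  linarith [le_ciInf key]

end FirstOrder

/-! ## §4 THE ENVELOPE THEOREM: the value function is differentiable at `w`, with derivative `V′ ∘ M` -/

section Envelope

variable {E F : Type*} [NormedAddCommGroup E] [NormedSpace ℝ E] [NormedAddCommGroup F] [NormedSpace ℝ F]

/-- The value of `φ` at `w` is attained at the constrained minimiser. [folklore] -/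
theorem constrValue_eq_of_isMinOn_fibre {V : E → ℝ} {D : E →L[ℝ] F} (hbdd : ∃ m, ∀ δ, m ≤ V δ) {w : F} {δ₀ : E} (hδ₀ : D δ₀ = w)
    (hmin : ∀ δ, D δ = w → V δ₀ ≤ V δ) : (⨅ δ : {δ // D δ = w}, V δ.1) = V δ₀ := by
  obtain ⟨m, hm⟩ := hbdd
  haveI : Nonempty {δ // D δ = w} := ⟨⟨δ₀, hδ₀⟩⟩
  have hb : BddBelow (range fun δ : {δ // D δ = w} => V δ.1) := ⟨m, forall_mem_range.2 fun δ => hm δ.1⟩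
  exact le_antisymm (ciInf_le hb ⟨δ₀, hδ₀⟩) (le_ciInf fun δ => hmin δ.1 δ.2)

/-- **THE ENVELOPE THEOREM FOR A LINEAR HARD CONSTRAINT.**  `V` bounded below, `δ₀` a minimiser of `V` on the fibre `{D δ = w}`,
`HasFDerivAt V V′ δ₀`, the convexity letter of `V` at `δ₀` (`V δ₀ + V′ (δ − δ₀) ≤ V δ`), `M` a continuous linear right inverse of `D` ⟹
`φ w′ = ⨅_{D δ = w′} V δ` is Fréchet differentiable at `w` with derivative `V′ ∘L M` (the multiplier; `M`-independent by §2): lower bound =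
§3 with `Q = 0` and Fermat (§1), upper bound = `φ (w + h) ≤ V (δ₀ + M h)` and the chain rule, squeeze in `o(h)`. [folklore] -/
theorem hasFDerivAt_constrValue {V : E → ℝ} {V' : E →L[ℝ] ℝ} {D : E →L[ℝ] F} {M : F →L[ℝ] E} (hM : ∀ w, D (M w) = w)
    (hbdd : ∃ m, ∀ δ, m ≤ V δ) {w : F} {δ₀ : E} (hδ₀ : D δ₀ = w) (hmin : ∀ δ, D δ = w → V δ₀ ≤ V δ)
    (hV : HasFDerivAt V V' δ₀) (hconv : ∀ δ, V δ₀ + V' (δ - δ₀) ≤ V δ) :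
    HasFDerivAt (fun w' => ⨅ δ : {δ // D δ = w'}, V δ.1) (V'.comp M) w := by
  have hφw : (⨅ δ : {δ // D δ = w}, V δ.1) = V δ₀ := constrValue_eq_of_isMinOn_fibre hbdd hδ₀ hmin
  obtain ⟨m, hm⟩ := hbdd
  have hbddV : ∀ v, BddBelow (range fun δ : {δ // D δ = v} => V δ.1) :=
    fun v => ⟨m, forall_mem_range.2 fun δ => hm δ.1⟩
  have hker : ∀ κ, D κ = 0 → V' κ = 0 := fun κ hκ => deriv_apply_eq_zero_of_isMinOn_fibre hδ₀ hmin hV hκ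
  have hlow : ∀ h : F, 0 ≤ (⨅ δ : {δ // D δ = w + h}, V δ.1) - (⨅ δ : {δ // D δ = w}, V δ.1) - (V'.comp M) h := by
    intro h
    have hfo : ∀ δ, V δ₀ + V' (δ - δ₀) + (fun _ : E => (0 : ℝ)) (δ - δ₀) ≤ V δ := fun δ => by simpa using hconv δ
    have h1 := firstOrder_constrValue hM ⟨m, hm⟩ (fun _ => le_rfl) hδ₀ hker hfo (w + h)
    have h0 : (⨅ δ : {δ // D δ = w + h - w}, (fun _ : E => (0 : ℝ)) δ.1) = 0 := by
      haveI : Nonempty {δ // D δ = w + h - w} := ⟨⟨M (w + h - w), hM _⟩⟩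
      exact ciInf_const
    rw [h0, add_zero, add_sub_cancel_left] at h1
    rw [ContinuousLinearMap.comp_apply]
    linarith
  have hup : ∀ h : F, (⨅ δ : {δ // D δ = w + h}, V δ.1) - (⨅ δ : {δ // D δ = w}, V δ.1) - (V'.comp M) h
      ≤ V (δ₀ + M h) - V δ₀ - (V'.comp M) h := by
    intro h
    have h1 : (⨅ δ : {δ // D δ = w + h}, V δ.1) ≤ V (δ₀ + M h) := ciInf_le (hbddV _) ⟨δ₀ + M h, by rw [map_add, hδ₀, hM]⟩
    rw [hφw]
    linarith
  have hs : (fun h : F => V (δ₀ + M h) - V δ₀ - (V'.comp M) h) =o[𝓝 0] fun h => h := by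
    have h1 : HasFDerivAt (fun h : F => δ₀ + M h) M 0 := (M.hasFDerivAt).const_add δ₀
    have h2 : HasFDerivAt V V' (δ₀ + M 0) := by simpa using hV
    have h3 := hasFDerivAt_iff_isLittleO_nhds_zero.1 (h2.comp (0 : F) h1)
    simpa using h3
  have hr : (fun h : F => (⨅ δ : {δ // D δ = w + h}, V δ.1) - (⨅ δ : {δ // D δ = w}, V δ.1) - (V'.comp M) h)
      =o[𝓝 0] fun h => h := by
    refine (isBigO_of_le _ fun h => ?_).trans_isLittleO hs
    rw [Real.norm_of_nonneg (hlow h), Real.norm_of_nonneg ((hlow h).trans (hup h))]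
    exact hup h
  exact hasFDerivAt_iff_isLittleO_nhds_zero.2 hr

/-- `fderiv` form of the envelope theorem. [folklore] -/
theorem fderiv_constrValue {V : E → ℝ} {V' : E →L[ℝ] ℝ} {D : E →L[ℝ] F} {M : F →L[ℝ] E} (hM : ∀ w, D (M w) = w)
    (hbdd : ∃ m, ∀ δ, m ≤ V δ) {w : F} {δ₀ : E} (hδ₀ : D δ₀ = w) (hmin : ∀ δ, D δ = w → V δ₀ ≤ V δ)
    (hV : HasFDerivAt V V' δ₀) (hconv : ∀ δ, V δ₀ + V' (δ - δ₀) ≤ V δ) :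
    fderiv ℝ (fun w' => ⨅ δ : {δ // D δ = w'}, V δ.1) w = V'.comp M :=
  (hasFDerivAt_constrValue hM hbdd hδ₀ hmin hV hconv).fderiv

/-- **THE END: THE ROAD's FIRST-ORDER LETTER FOR THE CONSTRAINED VALUE FUNCTION, WITH ITS OWN DERIVATIVE AND THE CONSTRAINED SCHUR
MODULUS.**  `V` bounded below, `Q ≥ 0`, `δ₀` a constrained minimiser over `w`, `HasFDerivAt V V′ δ₀` and the first-order letter of `V` at
`δ₀` with modulus form `Q` ⟹ for every `w′`:
`φ w + fderiv ℝ φ w (w′ − w) + Q_D (w′ − w) ≤ φ w′` (`φ w′ = ⨅_{D δ = w′} V δ`, `Q_D v = ⨅_{D δ = v} Q δ`). [folklore] -/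
theorem firstOrder_constrValue_fderiv {V Q : E → ℝ} {V' : E →L[ℝ] ℝ} {D : E →L[ℝ] F} {M : F →L[ℝ] E} (hM : ∀ w, D (M w) = w)
    (hbdd : ∃ m, ∀ δ, m ≤ V δ) (hQ0 : ∀ δ, 0 ≤ Q δ) {w : F} {δ₀ : E} (hδ₀ : D δ₀ = w) (hmin : ∀ δ, D δ = w → V δ₀ ≤ V δ)
    (hV : HasFDerivAt V V' δ₀) (hfo : ∀ δ, V δ₀ + V' (δ - δ₀) + Q (δ - δ₀) ≤ V δ) (w' : F) :
    (⨅ δ : {δ // D δ = w}, V δ.1) + fderiv ℝ (fun v => ⨅ δ : {δ // D δ = v}, V δ.1) w (w' - w)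
      + (⨅ δ : {δ // D δ = w' - w}, Q δ.1) ≤ ⨅ δ : {δ // D δ = w'}, V δ.1 := by
  have hconv : ∀ δ, V δ₀ + V' (δ - δ₀) ≤ V δ := fun δ => by linarith [hfo δ, hQ0 (δ - δ₀)]
  rw [fderiv_constrValue hM hbdd hδ₀ hmin hV hconv, ContinuousLinearMap.comp_apply]
  exact firstOrder_constrValue hM hbdd hQ0 hδ₀ (fun κ hκ => deriv_apply_eq_zero_of_isMinOn_fibre hδ₀ hmin hV hκ) hfo w'

end Envelope

/-! ## §5 Gradient ∕ multiplier currency: `∇φ(w) = M†∇V(δ₀) = λ`, the Lagrange condition `D†λ = ∇V(δ₀)`, uniqueness of `λ` -/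

section Multiplier

variable {E F : Type*} [NormedAddCommGroup E] [InnerProductSpace ℝ E] [CompleteSpace E]
  [NormedAddCommGroup F] [InnerProductSpace ℝ F] [CompleteSpace F]

/-- The dual vector of `M† g` is `⟪g, M ·⟫`: `toDual (M† g) = (toDual g) ∘L M`. [folklore] -/
theorem toDual_adjoint_apply (M : F →L[ℝ] E) (g : E) :
    InnerProductSpace.toDual ℝ F (ContinuousLinearMap.adjoint M g) = (InnerProductSpace.toDual ℝ E g).comp M := by
  ext h
  simp [InnerProductSpace.toDual_apply_apply, ContinuousLinearMap.adjoint_inner_left]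

/-- **THE ENVELOPE THEOREM IN GRADIENT CURRENCY**: `∇φ(w) = M†∇V(δ₀)`. Hypotheses as in §4 with `HasGradientAt V g δ₀` and the convexity
letter `V δ₀ + ⟪g, δ − δ₀⟫ ≤ V δ`. [folklore] -/
theorem hasGradientAt_constrValue {V : E → ℝ} {g : E} {D : E →L[ℝ] F} {M : F →L[ℝ] E} (hM : ∀ w, D (M w) = w)
    (hbdd : ∃ m, ∀ δ, m ≤ V δ) {w : F} {δ₀ : E} (hδ₀ : D δ₀ = w) (hmin : ∀ δ, D δ = w → V δ₀ ≤ V δ)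
    (hV : HasGradientAt V g δ₀) (hconv : ∀ δ, V δ₀ + ⟪g, δ - δ₀⟫ ≤ V δ) :
    HasGradientAt (fun w' => ⨅ δ : {δ // D δ = w'}, V δ.1) (ContinuousLinearMap.adjoint M g) w := by
  rw [hasGradientAt_iff_hasFDerivAt, toDual_adjoint_apply]
  refine hasFDerivAt_constrValue hM hbdd hδ₀ hmin (hasGradientAt_iff_hasFDerivAt.1 hV) fun δ => ?_
  simpa [InnerProductSpace.toDual_apply_apply] using hconv δ

omit [CompleteSpace F] in
/-- Fermat on the fibre in gradient currency: `⟪∇V(δ₀), κ⟫ = 0` on `ker D`. [folklore] -/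
theorem inner_gradient_eq_zero_of_isMinOn_fibre {V : E → ℝ} {g : E} {D : E →L[ℝ] F} {w : F} {δ₀ : E} (hδ₀ : D δ₀ = w)
    (hmin : ∀ δ, D δ = w → V δ₀ ≤ V δ) (hV : HasGradientAt V g δ₀) {κ : E} (hκ : D κ = 0) : ⟪g, κ⟫ = 0 := by
  have h := deriv_apply_eq_zero_of_isMinOn_fibre hδ₀ hmin (hasGradientAt_iff_hasFDerivAt.1 hV) hκ
  simpa [InnerProductSpace.toDual_apply_apply] using h

/-- `M†D† = 1` for a right inverse `M` of `D` (adjoint of `D M = 1`). [folklore] -/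
theorem adjoint_rightInverse_comp {D : E →L[ℝ] F} {M : F →L[ℝ] E} (hM : ∀ w, D (M w) = w) (μ : F) : ContinuousLinearMap.adjoint M (ContinuousLinearMap.adjoint D μ) = μ := by
  have hDM : D.comp M = ContinuousLinearMap.id ℝ F := by ext w; simp [hM w]
  simpa [ContinuousLinearMap.adjoint_comp] using congrArg (fun T : F →L[ℝ] F => T μ) (congrArg ContinuousLinearMap.adjoint hDM)

/-- **THE LAGRANGE CONDITION.**  If `g` annihilates `ker D` (`⟪g, κ⟫ = 0` whenever `D κ = 0` — §1 at a constrained minimiser) and `M` is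
a right inverse of `D`, then the multiplier `λ = M† g` satisfies `D† λ = g`: `…ConstrainedSchurForm`'s letter `H M = D†Λ` at one point
(`κ − M (D κ) ∈ ker D` for every `κ`). [folklore] -/
theorem adjoint_apply_multiplier {g : E} {D : E →L[ℝ] F} (hker : ∀ κ, D κ = 0 → ⟪g, κ⟫ = 0) {M : F →L[ℝ] E}
    (hM : ∀ w, D (M w) = w) : ContinuousLinearMap.adjoint D (ContinuousLinearMap.adjoint M g) = g := by
  refine ext_inner_right ℝ fun κ => ?_
  rw [ContinuousLinearMap.adjoint_inner_left, ContinuousLinearMap.adjoint_inner_left]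
  have h0 := hker (κ - M (D κ)) (by rw [map_sub, hM, sub_self])
  rw [inner_sub_right, sub_eq_zero] at h0
  exact h0.symm

/-- **THE MULTIPLIER IS UNIQUE**: `D† λ₁ = D† λ₂ ⟹ λ₁ = λ₂` as soon as `D` has a right inverse (`λ = M†(D†λ)`). [folklore] -/
theorem multiplier_unique {D : E →L[ℝ] F} {M : F →L[ℝ] E} (hM : ∀ w, D (M w) = w) {μ₁ μ₂ : F} (h : ContinuousLinearMap.adjoint D μ₁ = ContinuousLinearMap.adjoint D μ₂) :
    μ₁ = μ₂ := by
  rw [← adjoint_rightInverse_comp hM μ₁, ← adjoint_rightInverse_comp hM μ₂, h]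

/-- **THE GRADIENT OF THE VALUE FUNCTION IS THE LAGRANGE MULTIPLIER**: under §4's hypotheses (gradient currency) `∇φ(w) = λ` with
`D† λ = ∇V(δ₀)`, and `λ` is the only vector with that property. [folklore] -/
theorem gradient_constrValue_isMultiplier {V : E → ℝ} {g : E} {D : E →L[ℝ] F} {M : F →L[ℝ] E} (hM : ∀ w, D (M w) = w)
    (hbdd : ∃ m, ∀ δ, m ≤ V δ) {w : F} {δ₀ : E} (hδ₀ : D δ₀ = w) (hmin : ∀ δ, D δ = w → V δ₀ ≤ V δ)
    (hV : HasGradientAt V g δ₀) (hconv : ∀ δ, V δ₀ + ⟪g, δ - δ₀⟫ ≤ V δ) :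
    ContinuousLinearMap.adjoint D (gradient (fun w' => ⨅ δ : {δ // D δ = w'}, V δ.1) w) = g ∧
      ∀ μ : F, ContinuousLinearMap.adjoint D μ = g → μ = gradient (fun w' => ⨅ δ : {δ // D δ = w'}, V δ.1) w := by
  have hgrad : gradient (fun w' => ⨅ δ : {δ // D δ = w'}, V δ.1) w = ContinuousLinearMap.adjoint M g := (hasGradientAt_constrValue hM hbdd hδ₀ hmin hV hconv).gradient
  have hL : ContinuousLinearMap.adjoint D (ContinuousLinearMap.adjoint M g) = g :=
    adjoint_apply_multiplier (fun κ hκ => inner_gradient_eq_zero_of_isMinOn_fibre hδ₀ hmin hV hκ) hM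
  refine ⟨by rw [hgrad, hL], fun μ hμ => ?_⟩
  rw [hgrad]
  exact multiplier_unique hM (hμ.trans hL.symm)

end Multiplier

/-! ## §6 EVERYWHERE: under the strong first-order letter at every point the constrained minimiser EXISTS over every `w`
(proper `E`), so `φ` is differentiable everywhere and obeys the letter about every point — the data of the step alone -/

section Everywhere

variable {E F : Type*} [NormedAddCommGroup E] [NormedSpace ℝ E] [NormedAddCommGroup F] [NormedSpace ℝ F]

/-- COERCIVITY from the strong first-order letter at one point: `V δ₁ < V δ` once `‖δ − δ₁‖ > 2‖ℓ‖∕m`. [folklore] -/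
theorem lt_of_firstOrder_of_norm_gt {V : E → ℝ} {ℓ : E →L[ℝ] ℝ} {m : ℝ} (hm : 0 < m) {δ₁ : E}
    (hfo : ∀ δ, V δ₁ + ℓ (δ - δ₁) + m / 2 * ‖δ - δ₁‖ ^ 2 ≤ V δ) {δ : E} (hδ : 2 * ‖ℓ‖ / m < ‖δ - δ₁‖) : V δ₁ < V δ := by
  have h1 : -(‖ℓ‖ * ‖δ - δ₁‖) ≤ ℓ (δ - δ₁) := by
    have := ℓ.le_opNorm (δ - δ₁)
    rw [Real.norm_eq_abs] at this
    linarith [neg_abs_le (ℓ (δ - δ₁))]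
  have h2 : 2 * ‖ℓ‖ < m * ‖δ - δ₁‖ := by linarith [(div_lt_iff₀ hm).1 hδ]
  have h3 : 0 < ‖δ - δ₁‖ := lt_of_le_of_lt (by positivity) hδ
  nlinarith [hfo δ, norm_nonneg ℓ]

/-- BOUNDED BELOW from the strong first-order letter at one point: `V ≥ V δ₁ − ‖ℓ‖²∕(2m)`. [folklore] -/
theorem bddBelow_of_firstOrder {V : E → ℝ} {ℓ : E →L[ℝ] ℝ} {m : ℝ} (hm : 0 < m) {δ₁ : E}
    (hfo : ∀ δ, V δ₁ + ℓ (δ - δ₁) + m / 2 * ‖δ - δ₁‖ ^ 2 ≤ V δ) : ∃ c, ∀ δ, c ≤ V δ := by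
  refine ⟨V δ₁ - ‖ℓ‖ ^ 2 / (2 * m), fun δ => ?_⟩
  have h1 : -(‖ℓ‖ * ‖δ - δ₁‖) ≤ ℓ (δ - δ₁) := by
    have := ℓ.le_opNorm (δ - δ₁)
    rw [Real.norm_eq_abs] at this
    linarith [neg_abs_le (ℓ (δ - δ₁))]
  have h2 : ‖ℓ‖ * ‖δ - δ₁‖ ≤ ‖ℓ‖ ^ 2 / (2 * m) + m / 2 * ‖δ - δ₁‖ ^ 2 := by
    rw [← sub_nonneg]
    have : ‖ℓ‖ ^ 2 / (2 * m) + m / 2 * ‖δ - δ₁‖ ^ 2 - ‖ℓ‖ * ‖δ - δ₁‖ = (‖ℓ‖ - m * ‖δ - δ₁‖) ^ 2 / (2 * m) := by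
      field_simp
      ring
    rw [this]
    positivity
  linarith [hfo δ]

/-- **THE CONSTRAINED MINIMISER EXISTS** (proper `E`, e.g. finite-dimensional): `V` continuous with the strong first-order letter at one
fibre point `δ₁` of `w` ⟹ `∃ δ₀` on the fibre minimising `V` there (minimise over the compact `fibre ∩ closedBall δ₁ (2‖ℓ‖∕m)`; outside the
ball `V > V δ₁`). [folklore] -/
theorem exists_isMinOn_fibre [ProperSpace E] {V : E → ℝ} (hVc : Continuous V) {ℓ : E →L[ℝ] ℝ} {m : ℝ} (hm : 0 < m) {D : E →L[ℝ] F}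
    {w : F} {δ₁ : E} (hδ₁ : D δ₁ = w) (hfo : ∀ δ, V δ₁ + ℓ (δ - δ₁) + m / 2 * ‖δ - δ₁‖ ^ 2 ≤ V δ) :
    ∃ δ₀, D δ₀ = w ∧ ∀ δ, D δ = w → V δ₀ ≤ V δ := by
  set R : ℝ := 2 * ‖ℓ‖ / m with hR
  set K : Set E := {δ | D δ = w} ∩ Metric.closedBall δ₁ R with hK
  have hKc : IsCompact K := (isCompact_closedBall δ₁ R).inter_left (isClosed_eq D.continuous continuous_const)
  obtain ⟨δ₀, ⟨hδ₀D, -⟩, hδ₀⟩ := hKc.exists_isMinOn ⟨δ₁, hδ₁, Metric.mem_closedBall_self (by positivity)⟩ hVc.continuousOn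
  refine ⟨δ₀, hδ₀D, fun δ hδ => ?_⟩
  by_cases hb : ‖δ - δ₁‖ ≤ R
  · exact hδ₀ ⟨hδ, by rwa [Metric.mem_closedBall, dist_eq_norm]⟩
  · have h1 : V δ₁ < V δ := lt_of_firstOrder_of_norm_gt hm hfo (lt_of_not_ge hb)
    have h2 : V δ₀ ≤ V δ₁ := hδ₀ ⟨hδ₁, Metric.mem_closedBall_self (by positivity)⟩
    linarith

/-- **THE ENVELOPE THEOREM EVERYWHERE, FROM THE DATA ALONE** (the `a = ∞` twin of `…FluctuationStepDeriv`): `E` proper, `D` with a right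
inverse `M`, `V` with a derivative FIELD `V′` (`HasFDerivAt V (V′ δ) δ` at every `δ`) and the STRONG first-order letter at every point with a
modulus form `Q ≥ (m∕2)‖·‖²`, `m > 0` ⟹ over EVERY `w` a constrained minimiser `δ₀` exists and `φ` is differentiable at `w` with
derivative `V′ δ₀ ∘L M`. [folklore] -/
theorem hasFDerivAt_constrValue_of_firstOrder [ProperSpace E] {V Q : E → ℝ} {V' : E → E →L[ℝ] ℝ} {D : E →L[ℝ] F} {M : F →L[ℝ] E}
    (hM : ∀ w, D (M w) = w) (hV : ∀ δ, HasFDerivAt V (V' δ) δ) {m : ℝ} (hm : 0 < m) (hQ : ∀ δ, m / 2 * ‖δ‖ ^ 2 ≤ Q δ)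
    (hfo : ∀ δ δ', V δ + V' δ (δ' - δ) + Q (δ' - δ) ≤ V δ') (w : F) :
    ∃ δ₀, D δ₀ = w ∧ (∀ δ, D δ = w → V δ₀ ≤ V δ) ∧
      HasFDerivAt (fun w' => ⨅ δ : {δ // D δ = w'}, V δ.1) ((V' δ₀).comp M) w := by
  have hfo' : ∀ δ δ', V δ + V' δ (δ' - δ) + m / 2 * ‖δ' - δ‖ ^ 2 ≤ V δ' := fun δ δ' => by linarith [hfo δ δ', hQ (δ' - δ)]
  have hVc : Continuous V := continuous_iff_continuousAt.2 fun δ => (hV δ).continuousAt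
  obtain ⟨δ₀, hδ₀, hmin⟩ := exists_isMinOn_fibre hVc hm (hM w) (hfo' (M w))
  have hbdd : ∃ c, ∀ δ, c ≤ V δ := bddBelow_of_firstOrder hm (hfo' δ₀)
  have hQ0 : ∀ δ, 0 ≤ Q δ := fun δ => le_trans (by positivity) (hQ δ)
  exact ⟨δ₀, hδ₀, hmin, hasFDerivAt_constrValue hM hbdd hδ₀ hmin (hV δ₀)
    fun δ => by linarith [hfo δ₀ δ, hQ0 (δ - δ₀)]⟩

/-- **THE ROAD's LETTER FOR `φ` ABOUT EVERY POINT, FROM THE DATA ALONE** (the `a = ∞` twin of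
`…FluctuationStepLetters.stepMarginal_firstOrder`): hypotheses of `hasFDerivAt_constrValue_of_firstOrder` ⟹ `φ` is differentiable
everywhere and for all `w, w′`: `φ w + fderiv ℝ φ w (w′ − w) + Q_D (w′ − w) ≤ φ w′`, `Q_D v = ⨅_{D δ = v} Q δ`. [folklore] -/
theorem firstOrder_constrValue_of_firstOrder [ProperSpace E] {V Q : E → ℝ} {V' : E → E →L[ℝ] ℝ} {D : E →L[ℝ] F} {M : F →L[ℝ] E}
    (hM : ∀ w, D (M w) = w) (hV : ∀ δ, HasFDerivAt V (V' δ) δ) {m : ℝ} (hm : 0 < m) (hQ : ∀ δ, m / 2 * ‖δ‖ ^ 2 ≤ Q δ)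
    (hfo : ∀ δ δ', V δ + V' δ (δ' - δ) + Q (δ' - δ) ≤ V δ') (w w' : F) :
    DifferentiableAt ℝ (fun v => ⨅ δ : {δ // D δ = v}, V δ.1) w ∧
      (⨅ δ : {δ // D δ = w}, V δ.1) + fderiv ℝ (fun v => ⨅ δ : {δ // D δ = v}, V δ.1) w (w' - w)
        + (⨅ δ : {δ // D δ = w' - w}, Q δ.1) ≤ ⨅ δ : {δ // D δ = w'}, V δ.1 := by
  have hfo' : ∀ δ δ', V δ + V' δ (δ' - δ) + m / 2 * ‖δ' - δ‖ ^ 2 ≤ V δ' := fun δ δ' => by linarith [hfo δ δ', hQ (δ' - δ)]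
  obtain ⟨δ₀, hδ₀, hmin, hd⟩ := hasFDerivAt_constrValue_of_firstOrder hM hV hm hQ hfo w
  have hbdd : ∃ c, ∀ δ, c ≤ V δ := bddBelow_of_firstOrder hm (hfo' δ₀)
  have hQ0 : ∀ δ, 0 ≤ Q δ := fun δ => le_trans (by positivity) (hQ δ)
  exact ⟨hd.differentiableAt, firstOrder_constrValue_fderiv hM hbdd hQ0 hδ₀ hmin (hV δ₀) (hfo δ₀) w'⟩

end Everywhere

/-! ## §7 Toy check (kernel): the letters are jointly inhabited — `D = M = id`, `φ = V` -/

example {E : Type*} [NormedAddCommGroup E] [NormedSpace ℝ E] {V : E → ℝ} {V' : E →L[ℝ] ℝ} (hbdd : ∃ m, ∀ δ, m ≤ V δ) {w : E}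
    (hV : HasFDerivAt V V' w) (hconv : ∀ δ, V w + V' (δ - w) ≤ V δ) :
    HasFDerivAt (fun w' => ⨅ δ : {δ // (ContinuousLinearMap.id ℝ E) δ = w'}, V δ.1) (V'.comp (ContinuousLinearMap.id ℝ E)) w :=
  hasFDerivAt_constrValue (D := ContinuousLinearMap.id ℝ E) (M := ContinuousLinearMap.id ℝ E) (fun _ => rfl) hbdd rfl
    (fun δ hδ => by
      have hδ' : δ = w := hδ
      have := hconv δ
      rw [hδ', sub_self, map_zero, add_zero] at this
      exact le_of_eq (by rw [hδ'])) hV hconv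

end Summit.QuantumFields.BalabanUV.T4Continuum.NE7b.ConstrainedValueDeriv
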